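import Mathlib
import Summits.NavierStokesRegularity.NavierStokesRegularity.Theorems.TaoLadderRungTwoFlatCorePhaseLanding
import Summits.NavierStokesRegularity.NavierStokesRegularity.Theorems.TaoLadderRungTwoFlatCoreLanding
import HarnessLib

/-!
# The CORE-ZONE HOP OF THE FLAT TUBE, CLOSED up to the section time: `CoreClause (n+1)` at SOME section time
  `τ₁ ∈ [τ − 2C_aB, τ + 2C_aB]` from the anchored contraction, pulse data, the interface histories and one budget
  (helper for the K_A♭ parent item stmt-NavierStokesRegularity-22987 `FlatGapCertificatesV2`, children 1A/2A of route
  TaoLadderRungTwoFlat; cell harvest/h2-tao-ladder, p1 g22; `HopTube.TubeStepCore` for the flat tube, LADDER §49.5/§50.8/§51)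

Composition: `MirrorPulse.core_phase_landing_flat` (L5a + landing, amplitude-form inputs ⇒ `∃ κ h`, closeness to
`κΦ(·, τ+h)` in the contraction gauge on the core read-out sites) → conversion to the head gauge on `m ≥ −K` (a constant
`C_conv` with `g^{m⁺} ≤ C_conv·ω_{m−1}`, e.g. `max(g, b^{K+1})`) + an edge-shell bound valid for every admissible
`(κ, h)` → `HopTube.core_landing_at_section_time` (phase paid at second order, section-state dictionary, mismatch) with
the budget made MONOTONE in the unknown `(κ, h)` through `|κ| ≤ 3/2`, `|1−κ| ≤ C_aB`, `|h| ≤ 2C_aB`.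

* `HopTube.core_hop_flat_closed` — **`∃ τ₁, |τ₁ − τ| ≤ 2C_aB ∧ ∀ a > 0, budget(a) → CoreClause P i₀ u⋆ (n+1) (recentre X τ₁ a)`**
  with `u⋆ = sectionState A_* i₀ (Φ(1+·, τ))`. The section time is existential (it is the canonical rule's to pick);
  the remaining inputs are the anchored contraction `AnchoredHopContraction` (child 1A's certificate), pulse data
  (`M`, `M_w`, profile bound `q`, tail `η̂`, anchor data `Q_a`, `φ_a`, gauge profile `M_ω`), the hop flow's head-gauge bound
  `M_X` near `τ`, the initial core data `B`, `B′`, the interface histories `q̄`, `r̄`, `R_τ` (delivered by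
  `MirrorPulse.hop_apriori_flat_bounds`), the edge-shell bound `D` and ONE budget inequality.

* `headGauge_le_convConst_mul_geomGauge` — the conversion constant `C_conv = max(g, b^{K+1})` discharging `hCconv`.

HONEST FRAMING: a conditional estimate about MODEL-lattice solutions (Tao 2016 §4 vocabulary on `S♭`, flat clocks); the
anchored contraction and all bounds are HYPOTHESES; nothing certified; no item closed; nothing about the Navier–Stokes
equations.
-/

noncomputable section

-- the sub-problem namespace repeats the summit name by design (D-0017)
set_option linter.dupNamespace false

namespace Summit.NavierStokesRegularity.NavierStokesRegularity.Theorems.HopTube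

open Set Finset Literature.Analysis.FluidPDE Literature.Analysis.FluidPDE.TaoCascade QuadPolar MirrorPulse

/-- **THE CORE-ZONE HOP OF THE FLAT TUBE, CLOSED (up to the existential section time).** See the module docstring.
[cite: Tao2016AveragedNS, §4 (4.8), §6.3–6.4 (statement shape of the checkpoint step: re-centring, modulation); route TaoLadderRungTwoFlat, `HopTube.TubeStepCore` for the flat tube (LADDER §49.5 (b), §50.8, §51)] -/
theorem core_hop_flat_closed (P : TubeSchedule) {ε τ : ℝ} {Φ X : Fin 2 → ℤ → ℝ → ℝ} {i₀ : Fin 2}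
    {ρ C M Mw MX B B' q ηhat qbar rbar Rτ Qa φa CaB Cconv D Mω : ℝ} {n : ℕ}
    (hΦ : IsGlobalSol ε Φ) (hX : IsGlobalSol ε X) (hε : 0 ≤ ε) (hτ : 0 ≤ τ)
    (hg : 1 ≤ P.g) (hb : 1 ≤ P.b) (hA : 0 < P.Astar)
    (hΦb : ∀ i m t, |Φ i m t| ≤ M) (hXb : ∀ i m t, |X i m t| ≤ M)
    (hS2 : AnchoredHopContraction ε τ Φ (geomGauge P.g P.b) i₀ ρ C) (hq : 0 ≤ q)
    (hprof : ∀ (i : Fin 2) (k : ℤ), ¬(i = i₀ ∧ k = 0) →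
      geomGauge P.g P.b i k * |Φ i (k + 1) τ| ≤ q * (geomGauge P.g P.b i₀ 0 * |Φ i₀ 1 τ|))
    (hMw : 0 ≤ Mw) (hΦg : ∀ j k, ∀ t ∈ Icc (τ - 1) (τ + 1), headGauge P.g j k * |Φ j k t| ≤ Mw)
    (hMX : 0 ≤ MX) (hXg : ∀ j k, ∀ t ∈ Icc (τ - 1) (τ + 1), headGauge P.g j k * |X j k t| ≤ MX)
    (hB : ∀ i k, geomGauge P.g P.b i k * |truncFam (-(P.K : ℤ) - 1) (X - Φ) i k 0| ≤ B)
    (hB' : ∀ i k, headGauge P.g i k * |truncFam (-(P.K : ℤ) - 1) (X - Φ) i k 0| ≤ B')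
    (hηhat : 0 ≤ ηhat) (hVe : ∀ t ∈ Icc 0 τ, |Φ 1 (-(P.K : ℤ) - 1) t| ≤ ηhat)
    (hAe : ∀ t ∈ Icc 0 τ, |Φ 0 (-(P.K : ℤ) - 1 + 1) t| ≤ ηhat)
    (hqbar : 0 ≤ qbar) (hqh : ∀ t ∈ Icc 0 τ, |(X - Φ) 1 (-(P.K : ℤ) - 1) t| ≤ qbar)
    (hrbar : 0 ≤ rbar) (hrh : ∀ t ∈ Icc 0 τ, |(X - Φ) 0 (-(P.K : ℤ) - 1 + 1) t| ≤ rbar)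
    (hRτ : |(X - Φ) i₀ 1 τ| ≤ Rτ) (hQa : |quadTermOn shiftSetFlat 0 (mirrorTable ε ε) Φ i₀ 1 τ| ≤ Qa)
    (hφa : 0 < φa) (hφale : φa ≤ |Φ i₀ 1 τ|)
    (hCaB1 : C * B ≤ CaB) (hCaB2 : (Rτ + C * B * Qa) / φa ≤ CaB) (hCaB : CaB ≤ 1 / 2)
    (hCconv0 : 0 ≤ Cconv)
    (hCconv : ∀ (i : Fin 2) (m : ℤ), -(P.K : ℤ) ≤ m → headGauge P.g i m ≤ Cconv * geomGauge P.g P.b i (m - 1))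
    (hD0 : 0 ≤ D)
    (hDcore : Cconv *
      ((ρ * B + (1 + q) * ((tableAbsSum shiftSetFlat (mirrorTable ε ε) * P.g *
          ((B' + (qbar * (2 * ηhat + qbar + ε * (ηhat + rbar)) + rbar * (ηhat + ε * (2 * ηhat + rbar))) * τ)
            * Real.exp (2 * tableAbsSum shiftSetFlat (mirrorTable ε ε) * M * P.g * τ)) ^ 2
          + (geomGauge P.g P.b 0 (-(P.K : ℤ) - 1 + 1) * (qbar * (2 * ηhat + qbar + ε * (ηhat + rbar)))
            + geomGauge P.g P.b 1 (-(P.K : ℤ) - 1) * (rbar * (ηhat + ε * (2 * ηhat + rbar))))) * τ *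
          Real.exp (2 * tableAbsSum shiftSetFlat (mirrorTable ε ε) * M * max P.g P.b * τ)))
        + 12 * CaB ^ 2 * ((tableAbsSum shiftSetFlat (mirrorTable ε ε)) ^ 2 * P.g ^ 2 * Mw ^ 3)) ≤ D)
    (hDedge : ∀ κ h : ℝ, |κ - 1| ≤ CaB → |h| ≤ 2 * CaB → ∀ j : Fin 2,
      headGauge P.g j (-(P.K : ℤ) - 1) * |X j (-(P.K : ℤ) - 1) τ - κ * Φ j (-(P.K : ℤ) - 1) (τ + h)| ≤ D)
    (hMω0 : 0 ≤ Mω)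
    (hMω : ∀ (i : Fin 2) (k : ℤ), -(P.K : ℤ) ≤ k →
      geomGauge P.g P.b i k * |sectionState P.Astar i₀ (fun i k => Φ i (1 + k) τ) i k| ≤ Mω) :
    ∃ τ₁ : ℝ, |τ₁ - τ| ≤ 2 * CaB ∧ ∀ a : ℝ, 0 < a →
      (D + 2 * (tableAbsSum shiftSetFlat (mirrorTable ε ε)) ^ 2 * P.g ^ 2 * (MX ^ 3 + 2 * (3 / 2) * Mw ^ 3)
            * (2 * CaB) ^ 2
          + (2 * CaB) * ((3 / 2) * CaB * (tableAbsSum shiftSetFlat (mirrorTable ε ε) * P.g * Mw ^ 2)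
            + 2 * tableAbsSum shiftSetFlat (mirrorTable ε ε) * ((3 / 2) * M) * P.g * D
            + tableAbsSum shiftSetFlat (mirrorTable ε ε) * P.g * D ^ 2))
        + (D + 2 * (tableAbsSum shiftSetFlat (mirrorTable ε ε)) ^ 2 * P.g ^ 2 * (MX ^ 3 + 2 * (3 / 2) * Mw ^ 3)
              * (2 * CaB) ^ 2
            + (2 * CaB) * ((3 / 2) * CaB * (tableAbsSum shiftSetFlat (mirrorTable ε ε) * P.g * Mw ^ 2)
              + 2 * tableAbsSum shiftSetFlat (mirrorTable ε ε) * ((3 / 2) * M) * P.g * D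
              + tableAbsSum shiftSetFlat (mirrorTable ε ε) * P.g * D ^ 2))
          / geomGauge P.g P.b i₀ 0 / P.Astar * Mω ≤ a * P.δ (n + 1) →
      CoreClause P i₀ (sectionState P.Astar i₀ (fun i k => Φ i (1 + k) τ)) (n + 1) (recentre X τ₁ a) := by
  have hM0 : 0 ≤ M := (abs_nonneg _).trans (hΦb 0 0 0)
  have hT0 : 0 ≤ tableAbsSum shiftSetFlat (mirrorTable ε ε) := tableAbsSum_nonneg _ _
  have hg0 : 0 ≤ P.g := by linarith
  have hω₀ : 0 < geomGauge P.g P.b i₀ 0 := geomGauge_pos (by linarith) (by linarith) i₀ 0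
  have he : (-(P.K : ℤ) - 1) + 1 ≤ 0 := by omega
  -- the phase landing
  obtain ⟨κ, h, hκ1, hh2, hκ0, hland⟩ := core_phase_landing_flat (e := -(P.K : ℤ) - 1) hΦ hX hε hτ he hΦb hXb hg hb
    hS2 hq hprof hMw hΦg hB hB' hηhat hVe hAe hqbar hqh hrbar hrh hRτ hQa hφa hφale hCaB1 hCaB2 hCaB
  have hCaB0 : 0 ≤ CaB := (abs_nonneg _).trans hκ1
  have hh1 : |h| ≤ 1 := hh2.trans (by linarith)
  have hκabs : |κ| ≤ 3 / 2 := by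
    have h1 := (abs_le.mp hκ1).2
    rw [abs_of_nonneg hκ0]; linarith
  have h1κ : |1 - κ| ≤ CaB := by rw [abs_sub_comm]; exact hκ1
  -- the head-gauge landing datum on `m ≥ −K − 1`
  have hD : ∀ (j : Fin 2) (m : ℤ), -(P.K : ℤ) - 1 ≤ m →
      headGauge P.g j m * |X j m τ - κ * Φ j m (τ + h)| ≤ D := by
    intro j m hm
    rcases eq_or_lt_of_le hm with heq | hlt
    · rw [← heq]; exact hDedge κ h hκ1 hh2 j
    · have hm' : -(P.K : ℤ) ≤ m := by omega
      have h1 := hland j (m - 1) (by omega)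
      rw [sub_add_cancel] at h1
      have hω0 : 0 ≤ geomGauge P.g P.b j (m - 1) := (geomGauge_pos (by linarith) (by linarith) j (m - 1)).le
      calc headGauge P.g j m * |X j m τ - κ * Φ j m (τ + h)|
          ≤ Cconv * geomGauge P.g P.b j (m - 1) * |X j m τ - κ * Φ j m (τ + h)| :=
            mul_le_mul_of_nonneg_right (hCconv j m hm') (abs_nonneg _)
        _ = Cconv * (geomGauge P.g P.b j (m - 1) * |X j m τ - κ * Φ j m (τ + h)|) := by ring
        _ ≤ Cconv * _ := mul_le_mul_of_nonneg_left h1 hCconv0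
        _ ≤ D := hDcore
  have hΦa : Φ i₀ 1 τ ≠ 0 := by
    intro h0; rw [h0, abs_zero] at hφale; linarith
  refine ⟨τ - h, ?_, fun a ha hbudget => ?_⟩
  · have : τ - h - τ = -h := by ring
    rw [this, abs_neg]; exact hh2
  -- monotone budget: η₁(D, h, κ) ≤ η̄
  have hη : D + 2 * (tableAbsSum shiftSetFlat (mirrorTable ε ε)) ^ 2 * P.g ^ 2 * (MX ^ 3 + 2 * |κ| * Mw ^ 3) * h ^ 2
        + |h| * (|κ| * |1 - κ| * (tableAbsSum shiftSetFlat (mirrorTable ε ε) * P.g * Mw ^ 2)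
          + 2 * tableAbsSum shiftSetFlat (mirrorTable ε ε) * (|κ| * M) * P.g * D
          + tableAbsSum shiftSetFlat (mirrorTable ε ε) * P.g * D ^ 2)
      ≤ D + 2 * (tableAbsSum shiftSetFlat (mirrorTable ε ε)) ^ 2 * P.g ^ 2 * (MX ^ 3 + 2 * (3 / 2) * Mw ^ 3)
            * (2 * CaB) ^ 2
          + (2 * CaB) * ((3 / 2) * CaB * (tableAbsSum shiftSetFlat (mirrorTable ε ε) * P.g * Mw ^ 2)
            + 2 * tableAbsSum shiftSetFlat (mirrorTable ε ε) * ((3 / 2) * M) * P.g * D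
            + tableAbsSum shiftSetFlat (mirrorTable ε ε) * P.g * D ^ 2) := by
    rw [← sq_abs h]
    have hh0 : 0 ≤ |h| := abs_nonneg _
    gcongr
  have hk : 0 ≤ 1 / geomGauge P.g P.b i₀ 0 / P.Astar * Mω := by positivity
  have hη' := mul_le_mul_of_nonneg_right hη hk
  refine core_landing_at_section_time P hΦ hX hg hb hA hΦb hMw hΦg hMX hXg hh1 hκ0 hD0 hΦa hD hMω ha ?_
  have e1 : ∀ x : ℝ, x / geomGauge P.g P.b i₀ 0 / P.Astar * Mω = x * (1 / geomGauge P.g P.b i₀ 0 / P.Astar * Mω) := by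
    intro x; ring
  rw [e1] at hbudget ⊢
  linarith

/-- **The conversion constant `C_conv = max(g, b^{K+1})`**: on `m ≥ −K` the head gauge at `m` is at most
`max(g, b^{K+1})` times the contraction gauge one shell below — the hypothesis `hCconv` of `core_hop_flat_closed`
(`g ≥ 1`, `b ≥ 1`). [folklore; route TaoLadderRungTwoFlat, gauge bookkeeping for `TubeStepCore`] -/
theorem headGauge_le_convConst_mul_geomGauge {g b : ℝ} (hg : 1 ≤ g) (hb : 1 ≤ b) (K : ℕ) (i : Fin 2) {m : ℤ}
    (hm : -(K : ℤ) ≤ m) : headGauge g i m ≤ max g (b ^ (K + 1)) * geomGauge g b i (m - 1) := by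
  unfold headGauge geomGauge
  have hg0 : 0 ≤ g := by linarith
  have hb0 : 0 < b := by linarith
  rcases le_or_gt 1 m with h1 | h1
  · -- `m ≥ 1`: both gauges are powers of `g`
    have e1 : m.toNat = (m - 1).toNat + 1 := by omega
    have e2 : (-(m - 1)).toNat = 0 := by omega
    rw [e2, pow_zero, inv_one, mul_one, e1, pow_succ, mul_comm (g ^ (m - 1).toNat) g]
    exact mul_le_mul_of_nonneg_right (le_max_left _ _) (pow_nonneg hg0 _)
  · -- `−K ≤ m ≤ 0`: head gauge `1`, contraction gauge `b^{−(1−m)}`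
    have e1 : m.toNat = 0 := by omega
    have e2 : (m - 1).toNat = 0 := by omega
    rw [e1, e2, pow_zero, one_mul, ← div_eq_mul_inv, one_le_div (pow_pos hb0 _)]
    exact (pow_le_pow_right₀ hb (by omega)).trans (le_max_right _ _)

end Summit.NavierStokesRegularity.NavierStokesRegularity.Theorems.HopTube

end
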